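import Summits.Ventures.YMGap.FlowData.TubeFluxNonAnnihilation
import HarnessLib

/-!
# Venture YMGap, track Y3 FLOW-DATA — NO CENTRE-FLUX SECTOR `e ≠ 0` OF THE TUBE TRANSFER OPERATOR IS ANNIHILATED:
# `0 < ‖T ∘ P_e‖` for every `e ∈ ℤ₂^k ∖ {0}`, hence `E_e > 0` (in particular `E₂, E₃ > 0`) HYPOTHESIS-FREE for the
# `SU(2)` tube at every `β ≠ 0` (theorems only)

HONEST FRAMING: venture file of the cell `pub-ymgap` (QuantumFields programme), track Y3; sequel of
`FlowData/TubeFluxNonAnnihilation.lean` (axial sectors `ê_μ`, torelon energy `E₁`) covering ALL non-trivial flux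
sectors, so that `TubeFluxGap.tubeFluxEnergy_pos` (`E_e > 0` PROVIDED `0 < ‖T ∘ P_e‖`) becomes hypothesis-free for the
FLOW-TABLE's `E₂ = E_{(1,1,0)}` and `E₃ = E_{(1,1,1)}` rows as well.  Finite spatial torus `(ℤ/L)^k`; no number, no row,
nothing about `L → ∞`, the continuum, confinement or a mass gap.

THE WITNESS (multi-loop state).  For directions `ν₀, …, ν_{r−1}` (distinct) let `ℓ` be the closed forward lattice path
that winds the `ν₀`-cycle through the origin, then the `ν₁`-cycle, …: link `t = qL + j ↦ (j ê_{ν_q}, ν_q)`.  Its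
holonomy trace `W(b) = Re tr ρ(∏ₜ b(ℓ t))` is gauge invariant (`blockPath_trace_gaugeTransform`: the path is closed,
`prod_ofFn_telescope`), and a centre twist `s` inserts one central factor `z` per block `q` with `s_{ν_q} = 1`
(`blockPath_prod_fluxTwist`), so for `ρ(z) = −1` it is a twist eigenfunction with eigenvalue
`∏_q (−1)^{s_{ν_q}} = χ_e(s)`, `e` = the indicator of `{ν₀, …, ν_{r−1}}` (`blockPath_trace_fluxTwist`).  The general
witness theorem `tubeSectorNorm_pos_of_pathState` of the axial file (Haar chain along ANY injective link family with a
gauge-invariant trace) then gives **`tubeSectorNorm_pos_of_schurScalar`**: `0 < ‖T ∘ P_e‖` for every `e ≠ 0`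
(enumerate the support of `e`), any compact second-countable `G`, continuous `ρ` with `ρ(z) = −1`, `z` central,
non-zero Schur scalar.  For `SU(2)` (`β ≠ 0`): **`su2_tubeSectorNorm_pos`**, **`su2FluxEnergy_pos'`**
(`0 < su2FluxEnergy β k L e`, every `e ≠ 0`).

References: G. 't Hooft, Nucl. Phys. B 153 (1979) 141 [cite: tHooft1979Flux]; I. Montvay, G. Münster (1994) §3.2.6
[cite: MontvayMunster1994, §3.2.6].
-/

noncomputable section

open scoped BigOperators ENNReal
open MeasureTheory Filter Function
open Literature.MathematicalPhysics.QuantumFieldTheory Literature.Analysis.OperatorTheory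

namespace Summit.Ventures.YMGap.FlowData

/-! ### Algebra of the multi-loop path `t = qL + j ↦ (j ê_{ν_q}, ν_q)` -/

section BlockPath

variable {G : Type*} [Group G] {k L : ℕ} [NeZero L]

/-- Central prefactors can be pulled out of an ordered product:
`∏ₜ (pₜ fₜ) = (∏ₜ pₜ)(∏ₜ fₜ)` when every `pₜ` is central. [folklore] -/
theorem prod_ofFn_mul_of_mem_center : ∀ (m : ℕ) (p f : Fin m → G), (∀ t, p t ∈ Subgroup.center G) →
    (List.ofFn fun t => p t * f t).prod = (List.ofFn p).prod * (List.ofFn f).prod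
  | 0, p, f, _ => by simp
  | m + 1, p, f, hp => by
    rw [List.ofFn_succ, List.prod_cons, List.ofFn_succ, List.prod_cons, List.ofFn_succ, List.prod_cons,
      prod_ofFn_mul_of_mem_center m (fun t => p t.succ) (fun t => f t.succ) fun t => hp t.succ]
    have hc : (List.ofFn fun t : Fin m => p t.succ).prod ∈ Subgroup.center G :=
      Subgroup.list_prod_mem _ (fun x hx => by
        obtain ⟨t, rfl⟩ := (List.mem_ofFn' _ _).1 hx
        exact hp t.succ)
    have hcomm := Subgroup.mem_center_iff.1 hc (f 0)
    -- `p₀ f₀ (P F) = p₀ (f₀ P) F = p₀ (P f₀) F = (p₀ P) (f₀ F)`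
    have key : ∀ x : G, f 0 * ((List.ofFn fun t : Fin m => p t.succ).prod * x) =
        (List.ofFn fun t : Fin m => p t.succ).prod * (f 0 * x) := fun x => by
      rw [← mul_assoc, hcomm, mul_assoc]
    simp only [mul_assoc, key]

omit [NeZero L] in
/-- The position after the `t`-th step of the multi-loop path is the start of the `(t+1)`-st:
`(j ê_ν).shift ν = (j+1) ê_ν`, and at a block end `L ê_ν = 0 = 0 ê_{ν'}`. [folklore] -/
theorem blockPath_shift (ds : ℕ → Fin k) (t : ℕ) :
    Site.shift (Pi.single (ds (t / L)) (((t % L : ℕ)) : ZMod L) : Site k L) (ds (t / L)) =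
      Pi.single (ds ((t + 1) / L)) ((((t + 1) % L : ℕ)) : ZMod L) := by
  rw [Site.shift, ← Pi.single_add, ZMod.natCast_mod, ZMod.natCast_mod, Nat.cast_add, Nat.cast_one]
  by_cases h : L ∣ t + 1
  · -- block end: both sides vanish
    have h0 : ((t : ℕ) : ZMod L) + 1 = 0 := by
      have := (ZMod.natCast_eq_zero_iff (t + 1) L).2 h
      push_cast at this
      exact this
    rw [h0, Pi.single_zero, Pi.single_zero]
  · rw [Nat.succ_div, if_neg h, add_zero]

omit [NeZero L] in
/-- **A gauge transformation conjugates the multi-loop holonomy**: the path is closed at the origin.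
[folklore] -/
theorem blockPath_prod_gaugeTransform (r : ℕ) (ds : ℕ → Fin k) (γ : Site k L → G) (b : GaugeConfig k L G) :
    (List.ofFn fun t : Fin (r * L) => gaugeTransform γ b
        (Pi.single (ds ((t : ℕ) / L)) ((((t : ℕ) % L : ℕ)) : ZMod L), ds ((t : ℕ) / L))).prod =
      γ 0 * (List.ofFn fun t : Fin (r * L) =>
        b (Pi.single (ds ((t : ℕ) / L)) ((((t : ℕ) % L : ℕ)) : ZMod L), ds ((t : ℕ) / L))).prod * (γ 0)⁻¹ := by
  have h := prod_ofFn_telescope (r * L) (fun t => γ (Pi.single (ds (t / L)) (((t % L : ℕ)) : ZMod L)))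
    (fun t => b (Pi.single (ds (t / L)) (((t % L : ℕ)) : ZMod L), ds (t / L)))
  simp only [gaugeTransform, blockPath_shift]
  rw [h]
  simp only [Nat.zero_div, Nat.zero_mod, Nat.cast_zero, Pi.single_zero, Nat.mul_mod_left]

omit [NeZero L] in
/-- **A centre twist inserts central prefactors along the multi-loop path**:
`∏ₜ (twist b)(ℓ t) = (∏ₜ prefactorₜ) ∏ₜ b(ℓ t)`. [cite: tHooft1979Flux] -/
theorem blockPath_prod_fluxTwist {z : G} (hz : z ∈ Subgroup.center G) (s : Fin k → ZMod 2) (r : ℕ) (ds : ℕ → Fin k)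
    (b : GaugeConfig k L G) :
    (List.ofFn fun t : Fin (r * L) => fluxTwist z s b
        (Pi.single (ds ((t : ℕ) / L)) ((((t : ℕ) % L : ℕ)) : ZMod L), ds ((t : ℕ) / L))).prod =
      (List.ofFn fun t : Fin (r * L) => fluxTwistPrefactor (L := L) z s
        (Pi.single (ds ((t : ℕ) / L)) ((((t : ℕ) % L : ℕ)) : ZMod L), ds ((t : ℕ) / L))).prod *
      (List.ofFn fun t : Fin (r * L) =>
        b (Pi.single (ds ((t : ℕ) / L)) ((((t : ℕ) % L : ℕ)) : ZMod L), ds ((t : ℕ) / L))).prod := by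
  simp only [fluxTwist_apply]
  exact prod_ofFn_mul_of_mem_center (r * L) _ _ fun t => fluxTwistPrefactor_mem_center hz s _

/-- The twist prefactor on the link `t = qL + j` of the multi-loop path is `z` iff `s_{ν_q} = 1` and `j = 0`.
[folklore] -/
theorem fluxTwistPrefactor_blockPath (z : G) (s : Fin k → ZMod 2) (ds : ℕ → Fin k) (t : ℕ) :
    fluxTwistPrefactor (L := L) z s (Pi.single (ds (t / L)) (((t % L : ℕ)) : ZMod L), ds (t / L)) =
      if s (ds (t / L)) = 1 ∧ t % L = 0 then z else 1 := by
  unfold fluxTwistPrefactor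
  simp only [Pi.single_eq_same]
  have h : ((((t % L : ℕ)) : ZMod L) = 0) ↔ t % L = 0 := by
    rw [ZMod.natCast_eq_zero_iff]
    exact ⟨fun hd => Nat.eq_zero_of_dvd_of_lt hd (Nat.mod_lt _ (Nat.pos_of_ne_zero (NeZero.ne L))),
      fun h0 => by rw [h0]; exact dvd_zero _⟩
  simp only [h]

/-- The links of the multi-loop path are distinct when the directions `ν₀, …, ν_{r−1}` are. [folklore] -/
theorem blockPath_injective (r : ℕ) (ds : ℕ → Fin k) (hds : ∀ q q', q < r → q' < r → ds q = ds q' → q = q') :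
    Injective fun t : Fin (r * L) =>
      ((Pi.single (ds ((t : ℕ) / L)) ((((t : ℕ) % L : ℕ)) : ZMod L), ds ((t : ℕ) / L)) : Edge k L) := by
  have hL : 0 < L := Nat.pos_of_ne_zero (NeZero.ne L)
  intro t t' h
  have hd : ds ((t : ℕ) / L) = ds ((t' : ℕ) / L) := congrArg Prod.snd h
  have hq : (t : ℕ) / L = (t' : ℕ) / L :=
    hds _ _ (Nat.div_lt_of_lt_mul (lt_of_lt_of_eq t.2 (Nat.mul_comm r L)))
      (Nat.div_lt_of_lt_mul (lt_of_lt_of_eq t'.2 (Nat.mul_comm r L))) hd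
  have hj : ((((t : ℕ) % L : ℕ)) : ZMod L) = ((((t' : ℕ) % L : ℕ)) : ZMod L) := by
    have h1 := congrArg (fun e : Edge k L => e.1 (ds ((t : ℕ) / L))) h
    simp only [Pi.single_eq_same] at h1
    rw [hd] at h1
    simpa only [Pi.single_eq_same] using h1
  rw [ZMod.natCast_eq_natCast_iff', Nat.mod_eq_of_lt (Nat.mod_lt _ hL), Nat.mod_eq_of_lt (Nat.mod_lt _ hL)] at hj
  exact Fin.ext (by rw [← Nat.div_add_mod (t : ℕ) L, ← Nat.div_add_mod (t' : ℕ) L, hq, hj])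

end BlockPath

/-! ### Signs: the twist eigenvalue of the multi-loop trace is `χ_e(s)` -/

section Signs

variable {G : Type*} [Group G] {n k L : ℕ} [NeZero L] (ρ : G →* Matrix (Fin n) (Fin n) ℂ)

/-- The image of an ordered product of elements `z^{[cₜ]}`, `ρ(z) = −1`, is the sign `∏ₜ (−1)^{[cₜ]}` times `1`.
[folklore] -/
theorem map_prod_ofFn_ite {z : G} (hρz : ρ z = -1) : ∀ (m : ℕ) (c : Fin m → Prop) [DecidablePred c],
    ρ ((List.ofFn fun t => if c t then z else 1).prod) =
      ((∏ t, if c t then (-1 : ℝ) else 1 : ℝ) : ℂ) • (1 : Matrix (Fin n) (Fin n) ℂ)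
  | 0, c, _ => by simp
  | m + 1, c, _ => by
    rw [List.ofFn_succ, List.prod_cons, map_mul, map_prod_ofFn_ite hρz m (fun t => c t.succ), Fin.prod_univ_succ]
    by_cases h : c 0
    · simp only [h, if_true, hρz]
      rw [Complex.ofReal_mul, mul_smul, Complex.ofReal_neg, Complex.ofReal_one, neg_one_smul, neg_mul, one_mul]
    · simp only [h, if_false, map_one, one_mul]

/-- `Re tr((c • 1) M) = c · Re tr M` for a real scalar `c`. [folklore] -/
theorem re_trace_smul_one_mul (c : ℝ) (M : Matrix (Fin n) (Fin n) ℂ) :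
    (((c : ℂ) • (1 : Matrix (Fin n) (Fin n) ℂ)) * M).trace.re = c * M.trace.re := by
  rw [Matrix.smul_mul, Matrix.one_mul, Matrix.trace_smul, smul_eq_mul, Complex.re_ofReal_mul]

/-- The sign collected along the multi-loop path: one factor `(−1)^{s_{ν_q}}` per block (at `j = 0`).
[folklore] -/
theorem prod_blockPath_sign (s : Fin k → ZMod 2) (r : ℕ) (ds : ℕ → Fin k) :
    (∏ t : Fin (r * L), if s (ds ((t : ℕ) / L)) = 1 ∧ (t : ℕ) % L = 0 then (-1 : ℝ) else 1) =
      ∏ q : Fin r, if s (ds q) = 1 then (-1 : ℝ) else 1 := by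
  have hL : 0 < L := Nat.pos_of_ne_zero (NeZero.ne L)
  rw [← Fintype.prod_equiv finProdFinEquiv
    (fun p : Fin r × Fin L => if s (ds p.1) = 1 ∧ (p.2 : ℕ) = 0 then (-1 : ℝ) else 1) _ (fun p => ?_)]
  · rw [Fintype.prod_prod_type]
    refine Finset.prod_congr rfl fun q _ => ?_
    rw [Fintype.prod_eq_single (⟨0, hL⟩ : Fin L) (fun j hj => ?_)]
    · simp only [and_true]
    · have : (j : ℕ) ≠ 0 := fun h0 => hj (Fin.ext h0)
      simp only [this, and_false, if_false]
  · simp only [finProdFinEquiv_apply_val]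
    have h1 : ((p.2 : ℕ) + L * (p.1 : ℕ)) / L = p.1 := by
      rw [Nat.add_mul_div_left _ _ hL, Nat.div_eq_of_lt p.2.2, zero_add]
    have h2 : ((p.2 : ℕ) + L * (p.1 : ℕ)) % L = p.2 := by
      rw [Nat.add_mul_mod_self_left, Nat.mod_eq_of_lt p.2.2]
    rw [h1, h2]

/-- The sign character of the indicator `e` of `{ν₀, …, ν_{r−1}}` (distinct) is the product of the block signs:
`χ_e(s) = ∏_q (−1)^{s_{ν_q}}`. [folklore] -/
theorem fluxSign_eq_prod_blocks (s e : Fin k → ZMod 2) (r : ℕ) (ds : ℕ → Fin k)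
    (hds : ∀ q q', q < r → q' < r → ds q = ds q' → q = q') (he : ∀ ν, e ν = 1 ↔ ∃ q, q < r ∧ ds q = ν) :
    fluxSign e s = ∏ q : Fin r, if s (ds q) = 1 then (-1 : ℝ) else 1 := by
  classical
  unfold fluxSign
  set S : Finset (Fin k) := Finset.image (fun q : Fin r => ds q) Finset.univ with hS
  have hmem : ∀ ν, e ν = 1 ↔ ν ∈ S := fun ν => by
    rw [he, hS, Finset.mem_image]
    exact ⟨fun ⟨q, hq, h⟩ => ⟨⟨q, hq⟩, Finset.mem_univ _, h⟩, fun ⟨q, _, h⟩ => ⟨q, q.2, h⟩⟩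
  have h1 : ∀ ν, (if e ν = 1 ∧ s ν = 1 then (-1 : ℝ) else 1) =
      if ν ∈ S then (if s ν = 1 then (-1 : ℝ) else 1) else 1 := by
    intro ν
    by_cases hν : ν ∈ S
    · simp only [(hmem ν).2 hν, true_and, hν, if_true]
    · have : ¬ e ν = 1 := fun h => hν ((hmem ν).1 h)
      simp only [this, false_and, if_false, hν]
  simp_rw [h1]
  rw [Finset.prod_ite_mem, Finset.univ_inter, hS, Finset.prod_image]
  rintro q - q' - h
  exact Fin.ext (hds _ _ q.2 q'.2 h)

/-- **The multi-loop trace is a twist eigenfunction with eigenvalue `χ_e(s)`** (`ρ(z) = −1`, `z` central, `e` the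
indicator of the distinct directions `ν₀, …, ν_{r−1}`). [cite: tHooft1979Flux] -/
theorem blockPath_trace_fluxTwist {z : G} (hz : z ∈ Subgroup.center G) (hρz : ρ z = -1) (r : ℕ) (ds : ℕ → Fin k)
    (hds : ∀ q q', q < r → q' < r → ds q = ds q' → q = q') (e : Fin k → ZMod 2)
    (he : ∀ ν, e ν = 1 ↔ ∃ q, q < r ∧ ds q = ν) (s : Fin k → ZMod 2) (b : GaugeConfig k L G) :
    (ρ ((List.ofFn fun t : Fin (r * L) => fluxTwist z s b
        (Pi.single (ds ((t : ℕ) / L)) ((((t : ℕ) % L : ℕ)) : ZMod L), ds ((t : ℕ) / L))).prod)).trace.re =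
      fluxSign e s * (ρ ((List.ofFn fun t : Fin (r * L) =>
        b (Pi.single (ds ((t : ℕ) / L)) ((((t : ℕ) % L : ℕ)) : ZMod L), ds ((t : ℕ) / L))).prod)).trace.re := by
  classical
  rw [blockPath_prod_fluxTwist hz s r ds b, map_mul]
  simp_rw [fluxTwistPrefactor_blockPath]
  rw [map_prod_ofFn_ite ρ hρz (r * L) (fun t : Fin (r * L) => s (ds ((t : ℕ) / L)) = 1 ∧ (t : ℕ) % L = 0),
    re_trace_smul_one_mul, prod_blockPath_sign, fluxSign_eq_prod_blocks s e r ds hds he]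

end Signs

/-! ### Non-annihilation of every sector `e ≠ 0` -/

section All

variable {G : Type*} [Group G] [TopologicalSpace G] [IsTopologicalGroup G] [CompactSpace G]
  [MeasurableSpace G] [BorelSpace G] [SecondCountableTopology G] {n : ℕ} (ρ : G →* Matrix (Fin n) (Fin n) ℂ)
  (J : ℝ) {k L : ℕ} [NeZero L]

omit [TopologicalSpace G] [IsTopologicalGroup G] [CompactSpace G] [MeasurableSpace G] [BorelSpace G]
  [SecondCountableTopology G] [NeZero L] in
/-- Every non-zero flux label is the indicator of an enumeration of its support by distinct directions. [folklore] -/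
theorem exists_enum_support {e : Fin k → ZMod 2} (he : e ≠ 0) :
    ∃ (r : ℕ) (ds : ℕ → Fin k), (∀ q q', q < r → q' < r → ds q = ds q' → q = q') ∧
      ∀ ν, e ν = 1 ↔ ∃ q, q < r ∧ ds q = ν := by
  classical
  obtain ⟨μ₀, -⟩ : ∃ μ, e μ ≠ (0 : Fin k → ZMod 2) μ := Function.ne_iff.1 he
  obtain ⟨S, hS⟩ : ∃ S : Finset (Fin k), ∀ ν, ν ∈ S ↔ e ν = 1 :=
    ⟨Finset.univ.filter fun ν => e ν = 1, fun ν => by simp⟩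
  refine ⟨S.card, fun q => if h : q < S.card then (S.equivFin.symm ⟨q, h⟩ : Fin k) else μ₀, ?_, fun ν => ?_⟩
  · intro q q' hq hq' h
    simp only [hq, hq', dif_pos] at h
    have := S.equivFin.symm.injective (Subtype.ext h)
    exact Fin.mk.inj_iff.1 this
  · constructor
    · intro h1
      have hν : ν ∈ S := (hS ν).2 h1
      refine ⟨(S.equivFin ⟨ν, hν⟩ : ℕ), (S.equivFin ⟨ν, hν⟩).2, ?_⟩
      simp only [(S.equivFin ⟨ν, hν⟩).2, dif_pos, Fin.eta, Equiv.symm_apply_apply]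
    · rintro ⟨q, hq, rfl⟩
      simp only [hq, dif_pos]
      exact (hS _).1 (S.equivFin.symm ⟨q, hq⟩).2

/-- **No non-trivial flux sector is annihilated** (general compact group): for continuous `ρ` with `ρ(z) = −1`,
`z` central, `n ≠ 0` and a non-zero Schur scalar `λ` of the one-link weight `e^{J Re tr ρ}`, `0 < ‖T ∘ P_e‖` for
EVERY `e ≠ 0` — the multi-loop state winding once along each direction in the support of `e` is the witness.
[cite: tHooft1979Flux] -/
theorem tubeSectorNorm_pos_of_schurScalar (hρ : Continuous ρ) (hn : n ≠ 0) {z : G} (hz : z ∈ Subgroup.center G)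
    (hρz : ρ z = -1) {lam : ℝ} (hlam : lam ≠ 0)
    (hM : ∀ i j, ∫ c, (Real.exp (J * (ρ c).trace.re) : ℂ) * ρ c i j ∂haarProbability G = if i = j then (lam : ℂ) else 0)
    {e : Fin k → ZMod 2} (he : e ≠ 0) : 0 < tubeSectorNorm ρ z J k L e := by
  obtain ⟨r, ds, hds, hsupp⟩ := exists_enum_support he
  exact tubeSectorNorm_pos_of_pathState ρ J hρ hn hz hlam hM
    (fun t : Fin (r * L) => (Pi.single (ds ((t : ℕ) / L)) ((((t : ℕ) % L : ℕ)) : ZMod L), ds ((t : ℕ) / L)))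
    (blockPath_injective r ds hds) e
    (fun γ b => by
      rw [blockPath_prod_gaugeTransform, map_mul, map_mul, Matrix.trace_mul_cycle, ← map_mul, inv_mul_cancel, map_one,
        one_mul])
    (blockPath_trace_fluxTwist ρ hz hρz r ds hds e hsupp)

end All

/-! ### The cell's object: `SU(2)`, every sector `e ≠ 0`, every `β ≠ 0` -/

section SU2

open Literature.MathematicalPhysics.QuantumLattice (fundamentalRep continuous_fundamentalRep fundamentalRep_mem_unitaryGroup
  secondCountableTopology_su2)

/-- **No non-trivial flux sector of the `SU(2)` tube is annihilated**: `0 < ‖T ∘ P_e‖` for every `e ≠ 0`, every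
slice dimension `k`, side `L`, and every Wilson coupling `β ≠ 0`. [cite: tHooft1979Flux] -/
theorem su2_tubeSectorNorm_pos {β : ℝ} (hβ : β ≠ 0) (k L : ℕ) [NeZero L] {e : Fin k → ZMod 2} (he : e ≠ 0) :
    0 < tubeSectorNorm (fundamentalRep (Fin 2)) su2MinusOne (β / 2) k L e := by
  haveI : SecondCountableTopology (Matrix.specialUnitaryGroup (Fin 2) ℂ) := secondCountableTopology_su2
  exact tubeSectorNorm_pos_of_schurScalar (fundamentalRep (Fin 2)) (β / 2) (continuous_fundamentalRep (Fin 2))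
    two_ne_zero su2MinusOne_mem_center fundamentalRep_su2MinusOne (su2_schurScalar_ne_zero hβ)
    (su2_integral_exp_mul_apply (β / 2)) he

/-- **Every non-trivial flux costs energy on every finite `SU(2)` tube, hypothesis-free**:
`0 < su2FluxEnergy β k L e` for every `e ≠ 0` (in particular the FLOW-TABLE's `E₂`, `E₃`), every `k`, `L`, `β ≠ 0`.
Finite volume only. [folklore] -/
theorem su2FluxEnergy_pos' {β : ℝ} (hβ : β ≠ 0) (k L : ℕ) [NeZero L] {e : Fin k → ZMod 2} (he : e ≠ 0) :
    0 < su2FluxEnergy β k L e := by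
  haveI : SecondCountableTopology (Matrix.specialUnitaryGroup (Fin 2) ℂ) := secondCountableTopology_su2
  exact tubeFluxEnergy_pos (fundamentalRep (Fin 2)) (β / 2) (continuous_fundamentalRep (Fin 2))
    fundamentalRep_mem_unitaryGroup su2MinusOne_mem_center su2MinusOne_mul_self he
    (su2_tubeSectorNorm_pos hβ k L he)

end SU2

end Summit.Ventures.YMGap.FlowData
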